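import Mathlib
import Summits.SmoothPoincare4.SmoothPoincare4.Theorems.SoloInformedSectionSurgery

/-!
# `π₁` of surgery on a mapping torus along a section: the semidirect-product quotient

Solo unit `solo-SmoothPoincare4-informed`, session 11 — the dictionary step behind
`SoloInformedSectionSurgery`.  For a mapping torus `W = F ×_φ̂ S¹` one has
`π₁ W = G ⋊_ψ ℤ` (`G = π₁ F`, `ψ 1 = φ = φ̂_*`), and surgery along a section in the class of the loop
`w · t` kills exactly the normal closure of `w · t`.  The purely algebraic statement proved here:
for ANY group `G`, any action `ψ : ℤ → Aut G` with `φ := ψ 1`, and any `w ∈ G`,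

  `(G ⋊_ψ ℤ) ⧸ ⟪ w·t ⟫  ≃*  G ⧸ ⟪ x⁻¹ · w · φ(x) · w⁻¹ : x ∈ G ⟫`
  (`sectionSurgeryQuotientEquiv`; "substitute `t = w⁻¹`"),

so the surgered manifold is simply connected iff the section relators normally generate `G`
(`normalClosure_section_eq_top_iff`).  Combined with `SectionSurgery.normalClosure_commutators_eq_top_iff`
this is the complete group theory of Lemma `T_P` (§10) and Proposition 11.2 (ii)–(iii) (§11) of
HOME `paper/poincare-sphere-trick.md`.  Mathlib only (`SemidirectProduct.lift`, `QuotientGroup`).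
-/

namespace Summit.SmoothPoincare4.SmoothPoincare4.Theorems
namespace SectionSurgery

open Subgroup Multiplicative SemidirectProduct QuotientGroup

variable {G : Type*} [Group G] (ψ : Multiplicative ℤ →* MulAut G) (w : G)

/-- The loop `w · t` of the mapping torus, as an element of `G ⋊_ψ ℤ`. -/
def sectionLoop : G ⋊[ψ] Multiplicative ℤ := inl w * inr (ofAdd 1)

/-- The normal subgroup killed by the surgery: `⟪ w · t ⟫`. -/
abbrev sectionLoopClosure : Subgroup (G ⋊[ψ] Multiplicative ℤ) :=
  normalClosure {sectionLoop ψ w}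

/-- The normal subgroup of `G` generated by the section relators of `φ = ψ 1`. -/
abbrev sectionRelatorClosure : Subgroup G :=
  normalClosure (sectionRelators (ψ (ofAdd 1)).toMonoidHom w)

/-- `w · t ∈ ⟪w · t⟫`. -/
theorem sectionLoop_mem : sectionLoop ψ w ∈ sectionLoopClosure ψ w :=
  subset_normalClosure rfl

/-- Compatibility of `x ↦ [x]` with the action, needed for `SemidirectProduct.lift`: modulo the
section relators, `ψ n` acts as conjugation by `[w⁻¹] ^ n`. -/
theorem mk_aut_eq (n : Multiplicative ℤ) (x : G) :
    (mk (ψ n x) : G ⧸ sectionRelatorClosure ψ w) =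
      (mk w⁻¹ : G ⧸ sectionRelatorClosure ψ w) ^ n.toAdd * mk x *
        ((mk w⁻¹ : G ⧸ sectionRelatorClosure ψ w) ^ n.toAdd)⁻¹ := by
  -- the set of `n` for which the identity holds (for all `x`) is a subgroup containing `ofAdd 1`
  let c : G ⧸ sectionRelatorClosure ψ w := mk w⁻¹
  let S : Subgroup (Multiplicative ℤ) :=
    { carrier := {n | ∀ x : G, (mk (ψ n x) : G ⧸ sectionRelatorClosure ψ w) =
        c ^ n.toAdd * mk x * (c ^ n.toAdd)⁻¹}
      one_mem' := by
        intro x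
        simp [c]
      mul_mem' := by
        intro m n hm hn x
        simp only [Set.mem_setOf_eq] at hm hn ⊢
        rw [map_mul, MulAut.mul_apply, hm, hn, toAdd_mul, zpow_add]
        group
      inv_mem' := by
        intro n hn x
        simp only [Set.mem_setOf_eq] at hn ⊢
        have h := hn ((ψ n)⁻¹ x)
        rw [MulAut.apply_inv_self] at h
        rw [map_inv, toAdd_inv, zpow_neg, inv_inv, h]
        group }
  have h1 : ofAdd (1 : ℤ) ∈ S := by
    intro x
    simp only [toAdd_ofAdd, zpow_one, c]
    rw [eq_comm, ← inv_mul_eq_one]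
    simp only [mul_inv_rev, inv_inv, ← QuotientGroup.mk_inv, ← QuotientGroup.mk_mul]
    rw [QuotientGroup.eq_one_iff]
    -- `((w⁻¹ * x * w)⁻¹ ... )`: reduce to a conjugate of the relator at `x`
    have hrel : x⁻¹ * w * (ψ (ofAdd 1)).toMonoidHom x * w⁻¹ ∈ sectionRelatorClosure ψ w :=
      subset_normalClosure (mem_sectionRelators _ _ _)
    have hconj :=
      (inferInstance : (sectionRelatorClosure ψ w).Normal).conj_mem _ hrel w⁻¹
    simp only [MulEquiv.coe_toMonoidHom, inv_inv] at hconj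
    convert hconj using 1
    group
  have hS : n ∈ S := by
    have : n = ofAdd (1 : ℤ) ^ n.toAdd := by
      rw [← ofAdd_zsmul, smul_eq_mul, mul_one, ofAdd_toAdd]
    rw [this]
    exact S.zpow_mem h1 _
  exact hS x

/-- The surgery homomorphism `G ⋊_ψ ℤ → G ⧸ ⟪relators⟫`: `x ↦ [x]`, `t ↦ [w⁻¹]`. -/
noncomputable def sectionLift : G ⋊[ψ] Multiplicative ℤ →* G ⧸ sectionRelatorClosure ψ w :=
  SemidirectProduct.lift (mk' (sectionRelatorClosure ψ w))
    (zpowersHom (G ⧸ sectionRelatorClosure ψ w) (mk w⁻¹)) (by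
      intro n
      ext x
      simp only [MonoidHom.coe_comp, Function.comp_apply, MulEquiv.coe_toMonoidHom, mk'_apply,
        MulAut.conj_apply, zpowersHom_apply]
      exact mk_aut_eq ψ w n x)

/-- `sectionLift (inl x) = [x]`. -/
@[simp] theorem sectionLift_inl (x : G) :
    sectionLift ψ w (inl x) = (mk x : G ⧸ sectionRelatorClosure ψ w) := by
  simp [sectionLift]

/-- `sectionLift (t ^ n) = [w⁻¹] ^ n`. -/
@[simp] theorem sectionLift_inr (n : Multiplicative ℤ) :
    sectionLift ψ w (inr n) = (mk w⁻¹ : G ⧸ sectionRelatorClosure ψ w) ^ n.toAdd := by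
  simp [sectionLift]

/-- `sectionLift` is onto (already on `inl G`). -/
theorem sectionLift_surjective : Function.Surjective (sectionLift ψ w) := by
  intro y
  obtain ⟨x, rfl⟩ := QuotientGroup.mk_surjective y
  exact ⟨inl x, sectionLift_inl ψ w x⟩

/-- The section loop dies: `[w] · [w⁻¹] = 1`. -/
theorem sectionLift_sectionLoop : sectionLift ψ w (sectionLoop ψ w) = 1 := by
  rw [sectionLoop, map_mul, sectionLift_inl, sectionLift_inr, toAdd_ofAdd, zpow_one,
    ← QuotientGroup.mk_mul, mul_inv_cancel, QuotientGroup.mk_one]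

/-- `⟪w · t⟫ ≤ ker sectionLift`. -/
theorem sectionLoopClosure_le_ker : sectionLoopClosure ψ w ≤ (sectionLift ψ w).ker :=
  normalClosure_le_normal (by
    rintro _ rfl
    exact sectionLift_sectionLoop ψ w)

/-- Each section relator maps into `⟪w · t⟫` under `inl`: it equals
`inl x⁻¹ · (w t) · (inl x⁻¹)⁻¹ · (w t)⁻¹`. -/
theorem inl_sectionRelator_mem (x : G) :
    (inl (x⁻¹ * w * (ψ (ofAdd 1)).toMonoidHom x * w⁻¹) : G ⋊[ψ] Multiplicative ℤ) ∈
      sectionLoopClosure ψ w := by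
  have hγ := sectionLoop_mem ψ w
  have hconj : inl x⁻¹ * sectionLoop ψ w * (inl x⁻¹)⁻¹ ∈ sectionLoopClosure ψ w :=
    (inferInstance : (sectionLoopClosure ψ w).Normal).conj_mem _ hγ _
  have hprod := (sectionLoopClosure ψ w).mul_mem hconj ((sectionLoopClosure ψ w).inv_mem hγ)
  convert hprod using 1
  rw [MulEquiv.coe_toMonoidHom, map_mul, map_mul, map_mul, inl_aut, sectionLoop]
  simp only [map_inv, mul_inv_rev, inv_inv]
  group

/-- The section relators die in `(G ⋊ ℤ) ⧸ ⟪w · t⟫`, so `inl` descends to the quotient. -/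
theorem sectionRelatorClosure_le_ker :
    sectionRelatorClosure ψ w ≤ ((mk' (sectionLoopClosure ψ w)).comp inl).ker :=
  normalClosure_le_normal (by
    rintro _ ⟨x, rfl⟩
    rw [SetLike.mem_coe, MonoidHom.mem_ker, MonoidHom.coe_comp, Function.comp_apply, mk'_apply,
      QuotientGroup.eq_one_iff]
    exact inl_sectionRelator_mem ψ w x)

/-- The inverse direction: `G ⧸ ⟪relators⟫ → (G ⋊ ℤ) ⧸ ⟪w t⟫` induced by `inl`. -/
def sectionInv : G ⧸ sectionRelatorClosure ψ w →* (G ⋊[ψ] Multiplicative ℤ) ⧸ sectionLoopClosure ψ w :=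
  QuotientGroup.lift _ ((mk' (sectionLoopClosure ψ w)).comp inl) (sectionRelatorClosure_le_ker ψ w)

/-- `sectionInv [x] = [inl x]`. -/
@[simp] theorem sectionInv_mk (x : G) :
    sectionInv ψ w (mk x) = (mk (inl x) : (G ⋊[ψ] Multiplicative ℤ) ⧸ sectionLoopClosure ψ w) :=
  rfl

/-- `[·] = sectionInv ∘ sectionLift` on `G ⋊ ℤ` (checked on `inl` and on the generator `t`). -/
theorem mk'_eq_sectionInv_comp_sectionLift :
    mk' (sectionLoopClosure ψ w) = (sectionInv ψ w).comp (sectionLift ψ w) := by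
  refine SemidirectProduct.hom_ext ?_ ?_
  · ext x
    simp
  · refine MonoidHom.ext_mint ?_
    simp only [MonoidHom.coe_comp, Function.comp_apply, mk'_apply, sectionLift_inr, toAdd_ofAdd,
      zpow_one, sectionInv_mk]
    rw [QuotientGroup.eq]
    have := (sectionLoopClosure ψ w).inv_mem (sectionLoop_mem ψ w)
    simpa [sectionLoop, mul_inv_rev] using this

/-- `ker sectionLift = ⟪w · t⟫` (the factorisation `[·] = sectionInv ∘ sectionLift` gives `≤`). -/
theorem ker_sectionLift_eq : (sectionLift ψ w).ker = sectionLoopClosure ψ w := by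
  refine le_antisymm ?_ (sectionLoopClosure_le_ker ψ w)
  intro z hz
  rw [MonoidHom.mem_ker] at hz
  have : (mk z : (G ⋊[ψ] Multiplicative ℤ) ⧸ sectionLoopClosure ψ w) = 1 := by
    change mk' (sectionLoopClosure ψ w) z = 1
    rw [mk'_eq_sectionInv_comp_sectionLift, MonoidHom.coe_comp, Function.comp_apply, hz, map_one]
  exact (QuotientGroup.eq_one_iff z).mp this

/-- THE DICTIONARY.  `(G ⋊_ψ ℤ) ⧸ ⟪w · t⟫ ≃* G ⧸ ⟪x⁻¹ w φ(x) w⁻¹ : x⟫`, `φ = ψ 1`. -/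
noncomputable def sectionSurgeryQuotientEquiv :
    (G ⋊[ψ] Multiplicative ℤ) ⧸ sectionLoopClosure ψ w ≃* G ⧸ sectionRelatorClosure ψ w :=
  (QuotientGroup.quotientMulEquivOfEq (ker_sectionLift_eq ψ w).symm).trans
    (QuotientGroup.quotientKerEquivOfSurjective (sectionLift ψ w) (sectionLift_surjective ψ w))

/-- Simple connectivity criterion: `⟪w · t⟫` is all of `G ⋊ ℤ` iff the section relators normally
generate `G`. -/
theorem normalClosure_section_eq_top_iff :
    sectionLoopClosure ψ w = ⊤ ↔ sectionRelatorClosure ψ w = ⊤ := by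
  rw [← ker_sectionLift_eq, MonoidHom.ker_eq_top_iff]
  constructor
  · intro h
    rw [eq_top_iff]
    intro x _
    rw [← QuotientGroup.eq_one_iff, ← sectionLift_inl ψ w x, h, MonoidHom.one_apply]
  · intro h
    ext z
    rw [MonoidHom.one_apply]
    obtain ⟨y, hy⟩ := QuotientGroup.mk_surjective (sectionLift ψ w z)
    rw [← hy, QuotientGroup.eq_one_iff, h]
    exact Subgroup.mem_top y

/-- Inner monodromy, assembled with `SoloInformedSectionSurgery`: for `ψ 1 = μ_q` on a nontrivial
perfect group whose normal subgroups are central or everything, surgery along the section `w · t`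
gives the trivial group iff `w q` is not central. -/
theorem sectionLoopClosure_eq_top_iff_not_mem_center [Nontrivial G] (hG : commutator G = ⊤)
    (hnorm : ∀ N : Subgroup G, N.Normal → N ≤ center G ∨ N = ⊤) (q : G)
    (hψ : ψ (ofAdd 1) = MulAut.conj q) :
    sectionLoopClosure ψ w = ⊤ ↔ w * q ∉ center G := by
  rw [normalClosure_section_eq_top_iff, sectionRelatorClosure, hψ]
  exact normalClosure_sectionRelators_conj_eq_top_iff hG hnorm q w

end SectionSurgery
end Summit.SmoothPoincare4.SmoothPoincare4.Theorems
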